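import Summits.QuantumFields.QCD.Theses.HeatSlicedQuarks
import Summits.QuantumFields.QCD.Theorems.HeatSlicedQuarksInterleavedHeatSliceFlowStubDuhamelEntrywise
import Summits.QuantumFields.QCD.Theorems.HeatSlicedQuarksInterleavedHeatSliceFlowStubColumnIdentificationAux
import Summits.QuantumFields.QCD.Theorems.HeatSlicedQuarksSmallFieldUltracontractivityStubRowDuhamel
import Mathlib.Analysis.Normed.Algebra.MatrixExponential

/-!
# Stub `stub_tracedSplittingIdentity` of line `Sketch`
(crux `Summit.QuantumFields.QCD.Theses.HeatSlicedQuarks.TracedQuadraticParametrix`, item stmt-QuantumFields-17985)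

**The T*T splitting identity with one right Duhamel step.**  For square complex matrices `A, B` over a
finite index type, a real `s` and an index `p`, write `H_A = AᴴA`, `H_B = BᴴB`, `K_X(s) = e^{-sH_X}` and
`Δ(s) = K_A(s) − K_B(s)`.  Then

  `Re K_A(2s)(p,p) − Re K_B(2s)(p,p)
      = Σ_q |Δ(s)(q,p)|² − 2 Re ∫₀ˢ (K_B(2s−τ) (H_A − H_B) K_A(τ))(p,p) dτ`.

Proof.
1. T*T for columns (landed `sum_norm_sq_col_eq_re_apply_self`): `Re K_X(2s)(p,p) = Σ_q |K_X(s)(q,p)|²`.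
2. Pointwise polarization `|a|² − |b|² = |a − b|² + 2 Re (b̄ (a − b))`, summed over `q`.
3. `K_B(s)` is Hermitian (`isHermitian_exp_neg_smul`), so `Σ_q conj(K_B(s)(q,p)) Δ(s)(q,p) = (K_B(s) Δ(s))(p,p)`.
4. The landed entrywise Duhamel formula `stub_duhamelEntrywise` (with `X = H_B`, `Y = H_A`) gives
   `Δ(s)(q,p) = −∫₀ˢ (K_B(s−τ) (H_A − H_B) K_A(τ))(q,p) dτ`.
5. Summing against the row `K_B(s)(p,·)` (finite sum through the interval integral, the integrand being
   continuous in `τ`) and using the semigroup law `K_B(s) K_B(s−τ) = K_B(2s−τ)`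
   (`Matrix.exp_add_of_commute`) gives `(K_B(s) Δ(s))(p,p) = −∫₀ˢ (K_B(2s−τ)(H_A − H_B)K_A(τ))(p,p) dτ`.
6. Take real parts.  It is an exact identity; the hypothesis `0 ≤ s` of the registered statement is
   not needed.  No named facts are used (Mathlib and landed siblings only).
-/

noncomputable section

namespace Summit.QuantumFields.QCD.Cruxes.TracedQuadraticParametrix.Sketch

open Literature.MathematicalPhysics.QuantumLattice Literature.MathematicalPhysics.QuantumFieldTheory
  Literature.Probability.LatticeModels
open Summit.QuantumFields.QCD.Theses.HeatSlicedQuarks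
open Summit.QuantumFields.QCD.Cruxes.InterleavedHeatSliceFlow.Sketch
open Summit.QuantumFields.QCD.Cruxes.SmallFieldUltracontractivity.PointCentredAxialParabolic
open Summit.QuantumFields.QCD.Theorems.SmallFieldUltracontractivity.Negative
open MeasureTheory intervalIntegral
open scoped Matrix ComplexConjugate

section Helpers

variable {ι : Type} [Fintype ι] [DecidableEq ι]

/-- Pointwise polarization in `ℂ`: `|a|² − |b|² = |a − b|² + 2 Re (b̄ (a − b))`. -/
private theorem norm_sq_sub_norm_sq (a b : ℂ) :
    ‖a‖ ^ 2 - ‖b‖ ^ 2 = ‖a - b‖ ^ 2 + 2 * (star b * (a - b)).re := by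
  simp only [← Complex.normSq_eq_norm_sq, Complex.normSq_apply, Complex.mul_re, Complex.sub_re,
    Complex.sub_im, Complex.star_def, Complex.conj_re, Complex.conj_im]
  ring

omit [DecidableEq ι] in
/-- Summed polarization for the `p`-th columns of two square matrices:
`Σ_q |K_A(q,p)|² − Σ_q |K_B(q,p)|² = Σ_q |(K_A − K_B)(q,p)|² + 2 Re Σ_q conj(K_B(q,p)) (K_A − K_B)(q,p)`. -/
private theorem sum_polarization (KA KB : Matrix ι ι ℂ) (p : ι) :
    ∑ q, ‖KA q p‖ ^ 2 - ∑ q, ‖KB q p‖ ^ 2 =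
      ∑ q, ‖(KA - KB) q p‖ ^ 2 + 2 * (∑ q, star (KB q p) * (KA - KB) q p).re := by
  rw [← Finset.sum_sub_distrib, Complex.re_sum, Finset.mul_sum, ← Finset.sum_add_distrib]
  refine Finset.sum_congr rfl fun q _ => ?_
  rw [Matrix.sub_apply]
  exact norm_sq_sub_norm_sq (KA q p) (KB q p)

omit [DecidableEq ι] in
/-- For a Hermitian `K_B`, pairing the conjugate `p`-th column of `K_B` with the `p`-th column of `Δ` is
the `(p,p)` entry of `K_B Δ`: `Σ_q conj(K_B(q,p)) Δ(q,p) = (K_B Δ)(p,p)`. -/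
private theorem cross_eq_mul_apply {KB : Matrix ι ι ℂ} (hK : KB.IsHermitian) (Δ : Matrix ι ι ℂ)
    (p : ι) : ∑ q, star (KB q p) * Δ q p = (KB * Δ) p p := by
  rw [Matrix.mul_apply]
  refine Finset.sum_congr rfl fun q _ => ?_
  rw [hK.apply]

/-- Continuity of the two-sided heat conjugation `τ ↦ e^{-(s-τ)X} M e^{-τY}` (real-ray exponentials in
the `L^∞` operator normed algebra structure `Matrix.Norms.Operator`; the topology is the product one).
-- adapted from `duhamelEntrywise_continuous` in …StubDuhamelEntrywise.lean -/
private theorem continuous_twoSided (X M Y : Matrix ι ι ℂ) (s : ℝ) :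
    Continuous fun τ : ℝ =>
      NormedSpace.exp (-((s - τ : ℝ) : ℂ) • X) * M * NormedSpace.exp (-(τ : ℂ) • Y) := by
  have e1 : ∀ τ : ℝ, -((s - τ : ℝ) : ℂ) • X = (τ - s) • X := fun τ => by
    rw [← Complex.ofReal_neg, neg_sub, rowDuhamel_coe_smul]
  have e2 : ∀ τ : ℝ, -(τ : ℂ) • Y = τ • (-Y) := fun τ => by
    rw [neg_smul, ← smul_neg, rowDuhamel_coe_smul]
  simp only [e1, e2]
  open scoped Matrix.Norms.Operator in
  exact ((NormedSpace.exp_continuous.comp ((continuous_sub_right s).smul continuous_const)).mul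
    continuous_const).mul (NormedSpace.exp_continuous.comp (continuous_id.smul continuous_const))

/-- The landed entrywise Duhamel formula with the sign pushed through:
`(e^{-sY} − e^{-sX})(q,p) = −∫₀ˢ (e^{-(s−τ)X} (Y − X) e^{-τY})(q,p) dτ`. -/
private theorem duhamel_flip (X Y : Matrix ι ι ℂ) (s : ℝ) (q p : ι) :
    (NormedSpace.exp (-(s : ℂ) • Y) - NormedSpace.exp (-(s : ℂ) • X)) q p =
      -∫ τ in (0 : ℝ)..s, (NormedSpace.exp (-((s - τ : ℝ) : ℂ) • X) * (Y - X) *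
        NormedSpace.exp (-(τ : ℂ) • Y)) q p := by
  rw [← neg_sub (NormedSpace.exp (-(s : ℂ) • X)) (NormedSpace.exp (-(s : ℂ) • Y)), Matrix.neg_apply,
    stub_duhamelEntrywise ι X Y s q p, neg_neg, ← intervalIntegral.integral_neg]
  refine intervalIntegral.integral_congr fun τ _ => ?_
  rw [← neg_sub X Y, Matrix.mul_neg, Matrix.neg_mul, Matrix.neg_apply, neg_neg]

/-- **The cross term.**  `(e^{-sX} (e^{-sY} − e^{-sX}))(p,p) = −∫₀ˢ (e^{-(2s−τ)X} (Y − X) e^{-τY})(p,p) dτ`: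
the entrywise Duhamel formula summed against the row `e^{-sX}(p,·)`, and the semigroup law
`e^{-sX} e^{-(s−τ)X} = e^{-(2s−τ)X}`. -/
private theorem cross_term (X Y : Matrix ι ι ℂ) (s : ℝ) (p : ι) :
    (NormedSpace.exp (-(s : ℂ) • X) *
        (NormedSpace.exp (-(s : ℂ) • Y) - NormedSpace.exp (-(s : ℂ) • X))) p p =
      -∫ τ in (0 : ℝ)..s, (NormedSpace.exp (-((2 * s - τ : ℝ) : ℂ) • X) * (Y - X) *
        NormedSpace.exp (-(τ : ℂ) • Y)) p p := by
  -- the semigroup law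
  have hsg : ∀ τ : ℝ, NormedSpace.exp (-(s : ℂ) • X) * NormedSpace.exp (-((s - τ : ℝ) : ℂ) • X) =
      NormedSpace.exp (-((2 * s - τ : ℝ) : ℂ) • X) := fun τ => by
    have hsum : -((2 * s - τ : ℝ) : ℂ) • X = -(s : ℂ) • X + -((s - τ : ℝ) : ℂ) • X := by
      rw [← add_smul]
      congr 1
      push_cast
      ring
    rw [hsum, Matrix.exp_add_of_commute _ _ (((Commute.refl X).smul_left _).smul_right _)]
  -- integrability of the entries of the Duhamel integrand against the row
  have hint : ∀ q : ι, IntervalIntegrable (fun τ : ℝ => (NormedSpace.exp (-(s : ℂ) • X)) p q *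
      (NormedSpace.exp (-((s - τ : ℝ) : ℂ) • X) * (Y - X) * NormedSpace.exp (-(τ : ℂ) • Y)) q p)
      volume 0 s := fun q =>
    (((continuous_twoSided X (Y - X) Y s).matrix_elem q p).intervalIntegrable 0 s).const_mul _
  rw [Matrix.mul_apply]
  simp_rw [duhamel_flip X Y s _ p, mul_neg, ← intervalIntegral.integral_const_mul]
  rw [Finset.sum_neg_distrib, ← intervalIntegral.integral_finsetSum fun q _ => hint q]
  congr 1
  refine intervalIntegral.integral_congr fun τ _ => ?_
  rw [← hsg τ]
  simp only [Matrix.mul_assoc]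
  rw [← Matrix.mul_apply]

end Helpers

/-- **T*T splitting identity with one right Duhamel step** (registered stub
`stub_tracedSplittingIdentity` of line `Sketch`).  For square complex matrices `A, B`, `s ≥ 0` and an
index `p`, with `H_A = AᴴA`, `H_B = BᴴB`, `K_X(s) = e^{-sH_X}`, `Δ(s) = K_A(s) − K_B(s)`:
`Re K_A(2s)(p,p) − Re K_B(2s)(p,p) = Σ_q |Δ(s)(q,p)|² − 2 Re ∫₀ˢ (K_B(2s−τ)(H_A − H_B)K_A(τ))(p,p) dτ`.
T*T for columns, polarization, Hermitian symmetry of `K_B(s)`, the entrywise Duhamel formula and the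
semigroup law (see the module docstring). -/
theorem stub_tracedSplittingIdentity :
    ∀ (ι : Type) [Fintype ι] [DecidableEq ι] (A B : Matrix ι ι ℂ) (s : ℝ), 0 ≤ s → ∀ p : ι,
    ((NormedSpace.exp (-((2 * s : ℝ) : ℂ) • (Aᴴ * A))) p p).re -
        ((NormedSpace.exp (-((2 * s : ℝ) : ℂ) • (Bᴴ * B))) p p).re =
      (∑ q, ‖(NormedSpace.exp (-(s : ℂ) • (Aᴴ * A)) - NormedSpace.exp (-(s : ℂ) • (Bᴴ * B))) q p‖ ^ 2) -
        2 * (∫ τ in (0 : ℝ)..s, (NormedSpace.exp (-((2 * s - τ : ℝ) : ℂ) • (Bᴴ * B)) * (Aᴴ * A - Bᴴ * B) *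
              NormedSpace.exp (-(τ : ℂ) • (Aᴴ * A))) p p).re := by
  intro ι _ _ A B s _ p
  have hK : (NormedSpace.exp (-(s : ℂ) • (Bᴴ * B))).IsHermitian := isHermitian_exp_neg_smul B s
  rw [← sum_norm_sq_col_eq_re_apply_self A s p, ← sum_norm_sq_col_eq_re_apply_self B s p,
    sum_polarization, cross_eq_mul_apply hK, cross_term (Bᴴ * B) (Aᴴ * A) s p, Complex.neg_re]
  ring

end Summit.QuantumFields.QCD.Cruxes.TracedQuadraticParametrix.Sketch

end
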